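import Mathlib

/-!
# `ShadowGameWinR` (crux stmt-ResolutionOfSingularities-18182, route `ShadowGame`), negative side —
# part 3b: the shear `θ : z ↦ z + x/(1−x)` and its inverse

`phiS = x/(1−x)`, `shUp` (`θ`), `shDn` (`θ⁻¹`): substitutable, `θ⁻¹ ∘ θ = id` (so `θ` is injective),
`θ x = x`, `θ y = y`, `θ z = z + φ`, `θ W = (1 − x) z` for `W = z − x − xz` (the edge coordinate of
B's surface becomes a coordinate hyperplane up to a unit), and ORDER ONE SURVIVES `θ`
(`exists_lin_subst_up`, via `MvPowerSeries.le_order_subst` applied to `θ⁻¹`).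
Lead prover-line-stmt-ResolutionOfSingularities-18182-0, 2026-08-17.
-/

noncomputable section

set_option linter.dupNamespace false

namespace Summit.ResolutionOfSingularities.ResolutionOfSingularities.Theorems.ShadowGameWinR.Negative

open MvPowerSeries

variable {κ : Type} [Field κ]

section Shear

variable (κ)

/-- `φ = x/(1−x) = x + x² + x³ + …`. [folklore] -/
def phiS : MvPowerSeries (Fin 3) κ := X 0 * (1 - X 0)⁻¹

/-- The shear `θ`: `x ↦ x`, `y ↦ y`, `z ↦ z + φ`. [folklore] -/
def shUp : Fin 3 → MvPowerSeries (Fin 3) κ := fun j => if j = 2 then X 2 + phiS κ else X j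

/-- The inverse shear `θ⁻¹`: `z ↦ z − φ`. [folklore] -/
def shDn : Fin 3 → MvPowerSeries (Fin 3) κ := fun j => if j = 2 then X 2 - phiS κ else X j

/-- `(1 − x) · φ = x`. [folklore] -/
theorem one_sub_X_mul_phi : (1 - X 0) * phiS κ = X 0 := by
  have h : MvPowerSeries.constantCoeff ((1 : MvPowerSeries (Fin 3) κ) - X 0) ≠ 0 := by simp
  unfold phiS
  rw [mul_left_comm, MvPowerSeries.mul_inv_cancel _ h, mul_one]

/-- `φ` has no constant term. [folklore] -/
theorem constantCoeff_phi : MvPowerSeries.constantCoeff (phiS κ) = 0 := by simp [phiS]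

/-- The coefficient of `x · g` at `x¹` is the constant term of `g`. [folklore] -/
theorem coeff_single_X_mul (g : MvPowerSeries (Fin 3) κ) :
    MvPowerSeries.coeff (Finsupp.single 0 1) (X 0 * g) = MvPowerSeries.constantCoeff g := by
  classical
  rw [show (X 0 : MvPowerSeries (Fin 3) κ) = MvPowerSeries.monomial (Finsupp.single 0 1) 1 from
    MvPowerSeries.X_def 0, MvPowerSeries.coeff_monomial_mul, if_pos le_rfl, tsub_self, one_mul,
    MvPowerSeries.coeff_zero_eq_constantCoeff_apply]

/-- A coefficient of `x · g` at an exponent with `d 0 = 0` vanishes. [folklore] -/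
theorem coeff_X_mul_of_zero (g : MvPowerSeries (Fin 3) κ) {d : Fin 3 →₀ ℕ} (hd : d 0 = 0) :
    MvPowerSeries.coeff d (X 0 * g) = 0 := by
  classical
  rw [show (X 0 : MvPowerSeries (Fin 3) κ) = MvPowerSeries.monomial (Finsupp.single 0 1) 1 from
    MvPowerSeries.X_def 0, MvPowerSeries.coeff_monomial_mul, if_neg]
  intro hle
  have := hle 0
  simp [hd] at this

/-- The linear coefficient of `φ` in `x` is `1`. [folklore] -/
theorem coeff_single_zero_phi : MvPowerSeries.coeff (Finsupp.single 0 1) (phiS κ) = 1 := by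
  have h := congrArg (MvPowerSeries.coeff (Finsupp.single (0 : Fin 3) 1)) (one_sub_X_mul_phi κ)
  rw [sub_mul, one_mul, map_sub, MvPowerSeries.coeff_index_single_self_X, coeff_single_X_mul,
    constantCoeff_phi, sub_zero] at h
  exact h

/-- The coefficient of `φ` at `z¹` is `0`. [folklore] -/
theorem coeff_single_two_phi : MvPowerSeries.coeff (Finsupp.single 2 1) (phiS κ) = 0 := by
  unfold phiS
  exact coeff_X_mul_of_zero κ _ (by simp)

/-- `θ` is substitutable. [folklore] -/
theorem hasSubst_up : MvPowerSeries.HasSubst (shUp κ) :=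
  MvPowerSeries.hasSubst_of_constantCoeff_zero (fun j => by
    fin_cases j <;> simp [shUp, constantCoeff_phi])

/-- `θ⁻¹` is substitutable. [folklore] -/
theorem hasSubst_dn : MvPowerSeries.HasSubst (shDn κ) :=
  MvPowerSeries.hasSubst_of_constantCoeff_zero (fun j => by
    fin_cases j <;> simp [shDn, constantCoeff_phi])

/-- `θ⁻¹ x = x`. [folklore] -/
theorem subst_dn_X0 : MvPowerSeries.subst (shDn κ) (X 0 : MvPowerSeries (Fin 3) κ) = X 0 := by
  rw [MvPowerSeries.subst_X (hasSubst_dn κ)]; simp [shDn]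

/-- The inverse shear fixes `φ` (a series in `x` alone). [folklore] -/
theorem subst_dn_phi : MvPowerSeries.subst (shDn κ) (phiS κ) = phiS κ := by
  unfold phiS
  set q : MvPowerSeries (Fin 3) κ := 1 - X 0 with hq
  have h1 : MvPowerSeries.subst (shDn κ) q = q := by
    rw [hq, MvPowerSeries.subst_sub (hasSubst_dn κ), subst_dn_X0,
      ← MvPowerSeries.substAlgHom_apply (hasSubst_dn κ), map_one]
  have hcc : MvPowerSeries.constantCoeff q ≠ 0 := by simp [hq]
  have key : MvPowerSeries.subst (shDn κ) q⁻¹ * q = 1 := by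
    have h2 : MvPowerSeries.subst (shDn κ) q⁻¹ * MvPowerSeries.subst (shDn κ) q = 1 := by
      rw [← MvPowerSeries.subst_mul (hasSubst_dn κ), MvPowerSeries.inv_mul_cancel _ hcc,
        ← MvPowerSeries.substAlgHom_apply (hasSubst_dn κ), map_one]
    rwa [h1] at h2
  have hinv : MvPowerSeries.subst (shDn κ) q⁻¹ = q⁻¹ := (MvPowerSeries.eq_inv_iff_mul_eq_one hcc).mpr key
  rw [MvPowerSeries.subst_mul (hasSubst_dn κ), subst_dn_X0, hinv]

/-- `θ⁻¹ ∘ θ = id`. [folklore] -/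
theorem subst_dn_up (f : MvPowerSeries (Fin 3) κ) :
    MvPowerSeries.subst (shDn κ) (MvPowerSeries.subst (shUp κ) f) = f := by
  rw [MvPowerSeries.subst_comp_subst_apply (hasSubst_up κ) (hasSubst_dn κ)]
  have : (fun j : Fin 3 => MvPowerSeries.subst (shDn κ) (shUp κ j)) = X := by
    funext j
    fin_cases j
    · simp [shUp, MvPowerSeries.subst_X (hasSubst_dn κ), shDn]
    · simp [shUp, MvPowerSeries.subst_X (hasSubst_dn κ), shDn]
    · simp only [shUp, Fin.reduceFinMk, Fin.isValue, if_true]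
      rw [MvPowerSeries.subst_add (hasSubst_dn κ), MvPowerSeries.subst_X (hasSubst_dn κ), subst_dn_phi]
      simp [shDn]
  rw [this, MvPowerSeries.subst_self]; rfl

/-- `θ` is injective. [folklore] -/
theorem subst_up_injective :
    Function.Injective (MvPowerSeries.subst (shUp κ) : MvPowerSeries (Fin 3) κ → _) :=
  fun f g h => by rw [← subst_dn_up κ f, ← subst_dn_up κ g, h]

/-- `θ x = x`. [folklore] -/
theorem subst_up_X0 : MvPowerSeries.subst (shUp κ) (X 0 : MvPowerSeries (Fin 3) κ) = X 0 := by
  rw [MvPowerSeries.subst_X (hasSubst_up κ)]; simp [shUp]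

/-- `θ y = y`. [folklore] -/
theorem subst_up_X1 : MvPowerSeries.subst (shUp κ) (X 1 : MvPowerSeries (Fin 3) κ) = X 1 := by
  rw [MvPowerSeries.subst_X (hasSubst_up κ)]; simp [shUp]

/-- `θ z = z + φ`. [folklore] -/
theorem subst_up_X2 : MvPowerSeries.subst (shUp κ) (X 2 : MvPowerSeries (Fin 3) κ) = X 2 + phiS κ := by
  rw [MvPowerSeries.subst_X (hasSubst_up κ)]; simp [shUp]

/-- `θ W = (1 − x) z` for `W = z − x − xz`. [folklore] -/
theorem subst_up_W :
    MvPowerSeries.subst (shUp κ) (X 2 - X 0 - X 0 * X 2 : MvPowerSeries (Fin 3) κ) = (1 - X 0) * X 2 := by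
  rw [MvPowerSeries.subst_sub (hasSubst_up κ), MvPowerSeries.subst_sub (hasSubst_up κ),
    MvPowerSeries.subst_mul (hasSubst_up κ), subst_up_X0, subst_up_X2]
  have h := one_sub_X_mul_phi κ
  linear_combination h

/-- Series with zero constant term keep a zero constant term under `θ`. [folklore] -/
theorem constantCoeff_subst_up {f : MvPowerSeries (Fin 3) κ} (hf : MvPowerSeries.constantCoeff f = 0) :
    MvPowerSeries.constantCoeff (MvPowerSeries.subst (shUp κ) f) = 0 :=
  MvPowerSeries.constantCoeff_subst_eq_zero (hasSubst_up κ)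
    (fun j => by fin_cases j <;> simp [shUp, constantCoeff_phi]) hf

/-- A degree-one exponent on `Fin 3` is a `single i 1`. [folklore] -/
theorem exists_single_of_degree_one {d : Fin 3 →₀ ℕ} (hd : Finsupp.degree d = 1) :
    ∃ i, d = Finsupp.single i 1 := by
  rw [Finsupp.degree_eq_sum, Fin.sum_univ_three] at hd
  by_cases h0 : d 0 = 1
  · refine ⟨0, Finsupp.ext fun j => ?_⟩; fin_cases j <;> simp <;> omega
  by_cases h1 : d 1 = 1
  · refine ⟨1, Finsupp.ext fun j => ?_⟩; fin_cases j <;> simp <;> omega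
  · refine ⟨2, Finsupp.ext fun j => ?_⟩; fin_cases j <;> simp <;> omega

/-- Order one survives the shear: a series of order `1` has a non-zero LINEAR coefficient after `θ`.
[folklore] -/
theorem exists_lin_subst_up {w : MvPowerSeries (Fin 3) κ} (hw0 : MvPowerSeries.constantCoeff w = 0)
    (hw1 : ∃ i, MvPowerSeries.coeff (Finsupp.single i 1) w ≠ 0) :
    ∃ i, MvPowerSeries.coeff (Finsupp.single i 1) (MvPowerSeries.subst (shUp κ) w) ≠ 0 := by
  have hw : w.order = 1 := by
    apply le_antisymm
    · obtain ⟨i, hi⟩ := hw1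
      have := MvPowerSeries.order_le hi
      simpa [Finsupp.degree_single] using this
    · exact (MvPowerSeries.one_le_order_iff_constCoeff_eq_zero).mpr hw0
  have hge : (1 : ℕ∞) ≤ ⨅ j, (shDn κ j).order := by
    refine le_iInf fun j => ?_
    refine (MvPowerSeries.one_le_order_iff_constCoeff_eq_zero).mpr ?_
    fin_cases j <;> simp [shDn, constantCoeff_phi]
  have hle : (MvPowerSeries.subst (shUp κ) w).order ≤ 1 := by
    have h := MvPowerSeries.le_order_subst (hasSubst_dn κ) (MvPowerSeries.subst (shUp κ) w)
    rw [subst_dn_up, hw] at h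
    calc (MvPowerSeries.subst (shUp κ) w).order
        = 1 * (MvPowerSeries.subst (shUp κ) w).order := (one_mul _).symm
      _ ≤ (⨅ j, (shDn κ j).order) * (MvPowerSeries.subst (shUp κ) w).order := by gcongr
      _ ≤ 1 := h
  have hge1 : 1 ≤ (MvPowerSeries.subst (shUp κ) w).order :=
    (MvPowerSeries.one_le_order_iff_constCoeff_eq_zero).mpr (constantCoeff_subst_up κ hw0)
  have heq : (MvPowerSeries.subst (shUp κ) w).order = (1 : ℕ) := le_antisymm hle (by exact_mod_cast hge1)
  obtain ⟨⟨d, hd, hdeg⟩, -⟩ := (MvPowerSeries.order_eq_nat).mp heq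
  obtain ⟨i, rfl⟩ := exists_single_of_degree_one hdeg
  exact ⟨i, hd⟩

end Shear

end Summit.ResolutionOfSingularities.ResolutionOfSingularities.Theorems.ShadowGameWinR.Negative

end
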